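import Summits.CriticalPhenomena.SAWScalingLimit.Theorems.BoundaryClosureR.Negative.RootPin

/-!
# Negative knowledge on crux `BoundaryClosureR` (stmt-CriticalPhenomena-14004), cycle 2:
`BoundarySineLaw` is false at the root edge `e = a`

`not_boundarySineLaw` refutes, verbatim, the typed first lemma `BoundarySineLaw` of card
pick-half-plane (`Cruxes/BoundaryClosureR/Ideator2Sketch.lean`).  The law
`Im(conj κ · ι(e)) = ‖c_w - c_u‖ ‖mid e - c_{w'}‖ Z(e) sin((3/8)(W_e - W_b))` is correct for every
boundary mid-edge `e ≠ a` but the decl also quantifies over `(u', w') = (u, w)`, i.e. `e = a` with the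
trivial walk `γe` (`W_e = 0`, `F(a) = 1`): there `mid a - c_w = -(c_w - c_u)/2`, so the left side is
`+(ℓ²/2) sin((3/8) W_b)` while the right side is `-(ℓ²/2) sin((3/8) W_b)` (triage r1-1, on paper).
Witness: `Λ = Lam (1/16) false` (simply connected, cycle-1 tree family), root `a = {fj 1 (-1), fj 0 0}`,
`b = {fj 2 0, fj 3 (-1)}`, `γb` = the three-vertex row walk, whose winding is `-π` (computed through
the coordinate model: `winding = (π/3)·pturn`, `pturn = -3`), so `sin((3/8)W_b) = -sin(3π/8) ≠ 0`.
REPAIR: add `s(u', w') ≠ s(u, w)` (or state the root increment separately).  Everything proved.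
[folklore]
-/

noncomputable section

open Set Filter Topology Complex Finset
open Literature.Probability.RandomPlanarGeometry
open Literature.Probability.LatticeModels Literature.Probability.RandomPlanarGeometry.SAW
open Literature.Probability.RandomPlanarGeometry.SAW.HV

namespace Summit.CriticalPhenomena.SAWScalingLimit.Theorems.BoundaryClosureR.Negative

open BoundaryClosure.Negative

/-! ### The witness walk and its winding -/

/-- The lattice path `u, v₁, v₂, v₃, e` of the witness (outer root vertex, the three row-`0`
vertices, outer vertex of `b`). [folklore] -/
def sinePath : List HexVertex := [fj 1 (-1), fj 0 0, fj 1 0, fj 2 0, fj 3 (-1)]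

/-- Its coordinate image. [folklore] -/
theorem sinePath_map_toHV :
    sinePath.map toHV = [((0 : ℤ), (-1 : ℤ), true), (0, 0, false), (0, 0, true), (1, 0, false),
      (1, -1, true)] := by
  simp [sinePath, toHV, fj]

/-- The coordinate image is a lattice path … [folklore] -/
theorem isChain_sinePath : (sinePath.map toHV).IsChain hvGraph.Adj := by
  rw [sinePath_map_toHV]; decide

/-- … without backtracking … [folklore] -/
theorem noBacktrack_sinePath : ∀ (i : ℕ) (hi : i + 2 < (sinePath.map toHV).length),
    (sinePath.map toHV)[i] ≠ (sinePath.map toHV)[i + 2]'hi := by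
  intro i hi
  have h3 : i < 3 := by simp [sinePath] at hi; omega
  interval_cases i <;> decide +revert

/-- … making three right turns. [folklore] -/
theorem pturn_sinePath : pturn (sinePath.map toHV) = -3 := by
  rw [sinePath_map_toHV]; decide

/-- **The geometric winding of the witness path is `-π`.** [folklore] -/
theorem winding_sinePath : Literature.Probability.LatticeModels.winding (sinePath.map hexCenter) = -Real.pi := by
  have e1 : sinePath.map hexCenter =
      ((sinePath.map toHV).map fun x => emb (pos x)).map fun z => (3 : ℂ)⁻¹ * z + 0 := by
    simp only [List.map_map]
    refine List.map_congr_left fun f _ => ?_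
    simp only [Function.comp_apply, emb_pos_toHV, add_zero]
    rw [← mul_assoc, inv_mul_cancel₀ three_ne_zero, one_mul]
  rw [e1, winding_map_affine (inv_ne_zero three_ne_zero) 0,
    winding_map_emb_pos _ isChain_sinePath noBacktrack_sinePath, pturn_sinePath]
  push_cast
  ring

/-! ### The refutation -/

/-- **`BoundarySineLaw` (Ideator2Sketch, verbatim) is false**: at `e = a` (allowed by the decl) with
the trivial walk, both sides are `∓(ℓ²/2)·sin((3/8)W_b)`, which differ once `sin((3/8)W_b) ≠ 0`;
on `Lam (1/16) false` with `W_b = -π` this reads `-sin(3π/8)/6 = sin(3π/8)/6`.  Repair: require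
`s(u', w') ≠ s(u, w)`. [folklore] -/
theorem not_boundarySineLaw : ¬ (∀ (Λ : Finset HexVertex), hexDomainSimplyConnected Λ →
    ∀ (u w : HexVertex), hexGraph.Adj u w → u ∉ Λ → w ∈ Λ →
    ∀ b ∈ hexDomainBoundary Λ, ∀ γb : HexMidEdgeSAW Λ s(u, w) b,
    ∀ (u' w' : HexVertex), hexGraph.Adj u' w' → u' ∉ Λ → w' ∈ Λ →
    ∀ γe : HexMidEdgeSAW Λ s(u, w) s(u', w'),
      ((starRingEnd ℂ) ((hexCenter w - hexCenter u) *
            Complex.exp (Complex.I * (3 / 8 : ℂ) * (γb.winding : ℂ))) *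
          ((hexMidpoint s(u', w') - hexCenter w') *
            hexParafermionicObservable Λ s(u, w) hexCriticalFugacity (5 / 8) s(u', w'))).im =
        ‖hexCenter w - hexCenter u‖ * ‖hexMidpoint s(u', w') - hexCenter w'‖ *
          ‖hexParafermionicObservable Λ s(u, w) hexCriticalFugacity 0 s(u', w')‖ *
          Real.sin ((3 / 8 : ℝ) * (γe.winding - γb.winding))) := by
  intro H
  have hδ : (0 : ℝ) < 1 / 16 := by norm_num
  have hδ' : (1 / 16 : ℝ) ≤ 1 / 16 := le_rfl
  have hX := Xc_pos hδ (δ := (1 / 16 : ℝ))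
  have hrow : ∀ i : ℤ, 0 ≤ i → i ≤ 2 → fj i 0 ∈ Lam (1 / 16) false := fun i h0 h2 =>
    fj_row_zero_mem hδ hδ' false h0 (by simp only [rootCell, Bool.false_eq_true, ↓reduceIte]; omega)
  have hw : fj 0 0 ∈ Lam (1 / 16) false := hrow 0 le_rfl (by norm_num)
  have hu : fj 1 (-1) ∉ Lam (1 / 16) false := fj_one_neg_one_not_mem hδ hδ' false
  have hu3 : fj 3 (-1) ∉ Lam (1 / 16) false := fun h =>
    compl_of_neg hδ hδ' false (j := 3) (by norm_num) (Finset.mem_coe.2 h)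
  have huw : hexGraph.Adj (fj 1 (-1)) (fj 0 0) := by
    have := adj_fj_down (show (0 : ℤ) % 2 = 0 by omega) 0
    rw [zero_sub, zero_add] at this
    exact this.symm
  have h23 : hexGraph.Adj (fj 2 0) (fj 3 (-1)) := by
    have := adj_fj_down (show (2 : ℤ) % 2 = 0 by omega) 0
    rwa [zero_sub, show (2 : ℤ) + 1 = 3 by norm_num] at this
  have hb : s(fj 2 0, fj 3 (-1)) ∈ hexDomainBoundary (Lam (1 / 16) false) :=
    ⟨(SimpleGraph.mem_edgeSet hexGraph).2 h23, fj 3 (-1), fj 2 0, Sym2.eq_swap,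
      hrow 2 (by norm_num) le_rfl, hu3⟩
  have ha : s(fj 1 (-1), fj 0 0) ∈ hexDomainBoundary (Lam (1 / 16) false) :=
    ⟨(SimpleGraph.mem_edgeSet hexGraph).2 huw, fj 1 (-1), fj 0 0, rfl, hw, hu⟩
  -- the three-vertex row walk `γb : a → b`
  let γb : HexMidEdgeSAW (Lam (1 / 16) false) s(fj 1 (-1), fj 0 0) s(fj 2 0, fj 3 (-1)) :=
    { verts := [fj 0 0, fj 1 0, fj 2 0]
      subset := by
        intro v hv
        simp only [List.mem_cons, List.not_mem_nil, or_false] at hv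
        rcases hv with rfl | rfl | rfl
        · exact hw
        · exact hrow 1 (by norm_num) (by norm_num)
        · exact hrow 2 (by norm_num) le_rfl
      nodup := by simp [fj_inj]
      isChain := by
        refine List.IsChain.cons_cons ?_ (List.IsChain.cons_cons ?_ (List.isChain_singleton _))
        · simpa using adj_fj_succ 0 0
        · simpa using adj_fj_succ 1 0
      head_mem := by
        intro v hv
        simp only [List.head?_cons, Option.some.injEq] at hv
        subst hv; exact Sym2.mem_mk_right _ _
      getLast_mem := by
        intro v hv
        simp only [List.getLast?_cons_cons, List.getLast?_singleton, Option.some.injEq] at hv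
        subst hv; exact Sym2.mem_mk_left _ _
      eq_of_nil := fun h => by simp at h
      edges_nodup := fun _ => by simp [fj_inj]
      fst_mem := hexDomainBoundary_subset _ ha }
  have hWb : γb.winding = -Real.pi := by
    rw [γb.winding_eq_winding_map (u := fj 1 (-1)) (w₁ := fj 0 0) rfl hu (List.cons_ne_nil _ _)
      (e := fj 3 (-1)) (Or.inl ⟨rfl, rfl⟩)]
    exact winding_sinePath
  -- the trivial walk `γe : a → a`
  let γe : HexMidEdgeSAW (Lam (1 / 16) false) s(fj 1 (-1), fj 0 0) s(fj 1 (-1), fj 0 0) :=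
    HexMidEdgeSAW.trivial (hexDomainBoundary_subset _ ha)
  have hWe : γe.winding = 0 := HexMidEdgeSAW.winding_trivial _
  have h := H (Lam (1 / 16) false) (simplyConnected_Lam hδ hδ' false) (fj 1 (-1)) (fj 0 0) huw hu hw
    _ hb γb (fj 1 (-1)) (fj 0 0) huw hu hw γe
  rw [hWb, hWe, hexParafermionicObservable_self ha, hexParafermionicObservable_self ha] at h
  -- evaluate both sides
  have hd : hexCenter (fj 0 0) - hexCenter (fj 1 (-1)) = ((Real.sqrt 3 / 3 : ℝ) : ℂ) * Complex.I := by
    apply Complex.ext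
    · simp only [Complex.sub_re, re_hexCenter_fj, Complex.mul_re, Complex.ofReal_re, Complex.I_re,
        Complex.ofReal_im, Complex.I_im]
      push_cast; ring
    · simp only [Complex.sub_im, im_hexCenter_fj, Complex.mul_im, Complex.ofReal_re, Complex.I_re,
        Complex.ofReal_im, Complex.I_im]
      rw [show (0 : ℤ) % 2 = 0 by omega, show (1 : ℤ) % 2 = 1 by omega]
      push_cast; ring
  have hm : hexMidpoint s(fj 1 (-1), fj 0 0) - hexCenter (fj 0 0) =
      -(((Real.sqrt 3 / 6 : ℝ) : ℂ) * Complex.I) := by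
    have : hexMidpoint s(fj 1 (-1), fj 0 0) - hexCenter (fj 0 0) =
        -((hexCenter (fj 0 0) - hexCenter (fj 1 (-1))) / 2) := by
      rw [hexMidpoint_mk]; ring
    rw [this, hd]; push_cast; ring
  have hexp : Complex.exp (Complex.I * (3 / 8 : ℂ) * ((-Real.pi : ℝ) : ℂ)) =
      (Real.cos (3 / 8 * Real.pi) : ℂ) - (Real.sin (3 / 8 * Real.pi) : ℂ) * Complex.I := by
    rw [show Complex.I * (3 / 8 : ℂ) * ((-Real.pi : ℝ) : ℂ) = ((-(3 / 8 * Real.pi) : ℝ) : ℂ) * Complex.I by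
      push_cast; ring, Complex.exp_mul_I, ← Complex.ofReal_cos, ← Complex.ofReal_sin, Real.cos_neg,
      Real.sin_neg]
    push_cast; ring
  rw [hd, hm, hexp] at h
  simp only [map_mul, map_sub, Complex.conj_ofReal, Complex.conj_I, neg_neg, norm_neg, norm_mul,
    Complex.norm_real, Complex.norm_I, mul_one, Real.norm_eq_abs, Complex.mul_im, Complex.mul_re,
    Complex.neg_re, Complex.neg_im, Complex.sub_re, Complex.sub_im, Complex.ofReal_re,
    Complex.ofReal_im, Complex.I_re, Complex.I_im, mul_zero, zero_mul, sub_zero, zero_sub, add_zero,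
    zero_add, neg_zero, mul_neg, neg_mul] at h
  rw [abs_of_pos (by positivity), abs_of_pos (by positivity)] at h
  have hsin : 0 < Real.sin (3 / 8 * Real.pi) := by
    apply Real.sin_pos_of_pos_of_lt_pi <;> nlinarith [Real.pi_pos]
  have hpos : 0 < Real.sqrt 3 / 3 * (Real.sqrt 3 / 6) * ‖(1 : ℂ)‖ * Real.sin (3 / 8 * Real.pi) := by
    rw [norm_one]; positivity
  have hpos' : 0 < Real.sqrt 3 / 3 * Real.sin (3 / 8 * Real.pi) * (Real.sqrt 3 / 6) := by positivity
  linarith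

end Summit.CriticalPhenomena.SAWScalingLimit.Theorems.BoundaryClosureR.Negative

end
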